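import Mathlib
import Summits.KontsevichZagierPeriods.Zeta5Search.ThirdOrderRaise
import Summits.KontsevichZagierPeriods.Zeta5Search.ThirdOrderCorr
import Summits.KontsevichZagierPeriods.Zeta5Search.SecondOrderLive
import HarnessLib

/-!
# ζ(5) search — the LIVE PAIR at SECOND order: `σ₂(y) − σ₂(ȳ) + M σ(ȳ) = κ · τ(T)` (tools for gen-2 g10's THEOREM A⁗, P1)

Cell `pub-zeta5` (HONEST FRAMING: systematic search; no irrationality claim unless certified), typer seat generation 12.
`SecondOrderLive.live_pair` (typer g11) proved `σ(y) + σ(ȳ) = τ(T)` for a pole class `y` whose type list is a single raise of the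
palindrome `T`.  The raise pair identity (P1) of REPORT-gen2-g10 §6.4 at relative order `p²` needs the second-order combination
`σ₂(y) − σ₂(ȳ) + M σ(ȳ)` (`M` the top level, `ȳ` the conjugate class), which is again an INTEGER multiple of `τ(T)`:
`κ = L − k` for the interior raise `T + δ_k`, `κ = L + 2` for `y = 1 :: T`, `κ = −1` for `y = T ++ [1]` (`live_pair₂`).
Inputs: the second-order raise calculus (`typeW2_raiseAt`, `…_snocOne`, `…_consOne`, `typeV2_…`) and the vanishing of the translation
terms (`typeCorr_eq_zero_of_consClass`, `typeCorr2_eq_zero_of_consClass`).  Nothing here bears on irrationality.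
-/

noncomputable section

open Finset PowerSeries

namespace Summit.KontsevichZagierPeriods.Zeta5Search.SecondOrder

open Summit.KontsevichZagierPeriods.Zeta5Search.CasoratianValuation (InPolytope)
open Summit.KontsevichZagierPeriods.Zeta5Search.ClusterValuation
open Summit.KontsevichZagierPeriods.Zeta5Search.LevelClass (typeRho typeW typeV typeExp classSet_level level_injective level_mem
  classPoles_level typeW_congr typeV_congr)
open Summit.KontsevichZagierPeriods.Zeta5Search.CellKit (conj_level netExp_conj_level)

variable {p : ℕ} [hp : Fact p.Prime]

section Live

variable (b : ℕ → ℤ) (hb : InPolytope b) (hpn : (p : ℤ) ≤ b 0)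
  {T : List ℤ} (hT : T.reverse = T) {y : ℕ} (hy : y < p) (hpole : 1 ≤ classPoleCount b p y) (hneg : classExp b p y < -1)
include hb hpn hT hy hpole hneg

/-- **LIVE PAIR at second order.**  If the type list of the pole class `y` (`E_y < −1`) is a single raise of the palindrome `T`,
then for an INTEGER `κ`: `ŵ₂_y − ŵ₂_ȳ + M ŵ_ȳ = κ τ_W(T)` and `v̂₂_y − v̂₂_ȳ + M v̂_ȳ = κ τ_V(T)` (`M` = top level of `y`). -/
theorem live_pair₂ (hr : isRaise T (classTypeList b p y) = true) :
    ∃ κ : ℤ, wHat2 b p y - wHat2 b p (conjClass b p y) + (topLevel b p y : ℚ) * wHat b p (conjClass b p y) =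
        (κ : ℚ) * typeTauW (tTop T) (tList T) ∧
      vHat2 b p y - vHat2 b p (conjClass b p y) + (topLevel b p y : ℚ) * vHat b p (conjClass b p y) =
        (κ : ℚ) * typeTauV (tTop T) (tList T) := by
  have h0 : 0 ≤ b 0 := hb.1.1
  have hp0 : 0 < p := hp.out.pos
  have hyn := le_b0_of_lt b hpn hy
  have hpnN : p ≤ (b 0).toNat := by have := hb.1.1; omega
  obtain ⟨hL, hL'⟩ := level_bounds' (p := p) b hyn
  set M := topLevel b p y with hMdef
  set f : ℕ → ℤ := fun k => netExp b (y + k * p) with hfdef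
  have hf : ∀ k ≤ M, netExp b (y + k * p) = f k := fun k _ => rfl
  have hpalT := tList_pal hT
  -- a pole among the levels
  have hfneg : ∃ i ≤ M, f i < 0 := by
    obtain ⟨q, hq⟩ := card_pos.1 (show 0 < ((classSet b p y).filter fun s => netExp b s < 0).card from hpole)
    have hP : (classSet b p y).filter (fun s => netExp b s < 0) =
        ((range (M + 1)).filter fun k => f k < 0).image fun k => y + k * p := classPoles_level b hy hL hL' f hf
    rw [hP] at hq
    obtain ⟨k, hk, -⟩ := mem_image.1 hq
    obtain ⟨hkr, hkneg⟩ := mem_filter.1 hk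
    exact ⟨k, by have := mem_range.1 hkr; omega, hkneg⟩
  -- the conjugate class
  obtain ⟨hy', hM2, hM2'⟩ := conj_level b hy hL hL'
  have hfc : ∀ k ≤ M, netExp b (conjClass b p y + k * p) = f (M - k) := fun k hk => netExp_conj_level b hL hL' h0 hk
  have hTne : T ≠ [] := by
    rintro rfl
    rw [classTypeList_level b hL hL'] at hr
    unfold isRaise at hr
    simp only [List.length_nil, List.range_zero, List.any_nil, Bool.false_or, Bool.or_eq_true, beq_iff_eq,
      List.nil_append, or_self] at hr
    have h1 := congrArg List.length hr
    simp only [List.length_map, List.length_range, List.length_cons, List.length_nil] at h1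
    have hM0 : M = 0 := by omega
    obtain ⟨i, hi, hfi⟩ := hfneg
    have hi0 : i = 0 := by omega
    subst hi0
    rw [hM0] at hr
    have h01 : netExp b y = 1 := by simpa using hr
    have h02 : f 0 = netExp b y := by show netExp b (y + 0 * p) = _; simp
    omega
  rw [← range_map_tList hTne, classTypeList_level b hL hL'] at hr
  -- no odd centre in the class of `y`, nor in its conjugate
  have hc0 : ¬ (¬ (2 : ℤ) ∣ b 0 ∧ CentreIn b p y) := by
    rintro ⟨hodd, hcen⟩
    have hself := (centreIn_iff_conjClass_eq b hpnN hy).1 hcen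
    have hfpal : ∀ k ≤ M, f (M - k) = f k := by
      intro k hk; rw [← hfc k hk, hself]
    have h2 := even_of_pal_raise hpalT hfpal hfneg hr
    exact odd_L_of_centre b hy hL hL' hodd hcen h0 h2
  have hc0' : ¬ (¬ (2 : ℤ) ∣ b 0 ∧ CentreIn b p (conjClass b p y)) :=
    fun h => hc0 ⟨h.1, (centreIn_conj_iff b h0 hyn).1 h.2⟩
  have hnegc : classExp b p (conjClass b p y) < -1 := by rw [classExp_conj b h0 hyn]; exact hneg
  -- the functionals as type functionals
  have hw2 : wHat2 b p y = typeW2 M f := wHat2_level₀ b hy hL hL' f hf hc0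
  have hv2 : vHat2 b p y = typeV2 M f := vHat2_level₀ b hy hL hL' f hf hc0
  have hwc : wHat b p (conjClass b p y) = typeW M (fun k => f (M - k)) := wHat_level₀ b hy' hM2 hM2' _ hfc hc0'
  have hvc : vHat b p (conjClass b p y) = typeV M (fun k => f (M - k)) := vHat_level₀ b hy' hM2 hM2' _ hfc hc0'
  have hw2c : wHat2 b p (conjClass b p y) = typeW2 M (fun k => f (M - k)) := wHat2_level₀ b hy' hM2 hM2' _ hfc hc0'
  have hv2c : vHat2 b p (conjClass b p y) = typeV2 M (fun k => f (M - k)) := vHat2_level₀ b hy' hM2 hM2' _ hfc hc0'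
  rw [hw2, hv2, hwc, hvc, hw2c, hv2c]
  rcases isRaise_level hr with ⟨k, hk, hML, hfk⟩ | ⟨hML, hfk⟩ | ⟨hML, hfk⟩
  · -- interior raise at level `k`; the conjugate is the raise at `M − k`
    have e1 : ∀ j ≤ M, f j = raiseAt (tList T) k j := fun j hj => hfk j (by omega)
    have e2 : ∀ j ≤ M, f (M - j) = raiseAt (tList T) (M - k) j := by
      intro j hj
      show netExp b (y + (M - j) * p) = _
      have hpj : tList T (M - j) = tList T j := by rw [hML]; exact hpalT j (by omega)
      rw [hfk (M - j) (by omega), raiseAt, raiseAt, hpj]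
      by_cases hjk : j = M - k
      · rw [if_pos (by omega), if_pos hjk]
      · rw [if_neg (by omega), if_neg hjk]
    refine ⟨((M - k : ℕ) : ℤ), ?_, ?_⟩
    · rw [typeW2_congr e1, typeW2_congr e2, typeW_congr e2, typeW2_raiseAt _ (by omega : k ≤ M),
        typeW2_raiseAt _ (by omega : M - k ≤ M), typeW_raiseAt _ (by omega : M - k ≤ M), typeTauW, hML]
      push_cast [Nat.cast_sub hk]
      ring
    · rw [typeV2_congr e1, typeV2_congr e2, typeV_congr e2, typeV2_raiseAt _ (by omega : k ≤ M),
        typeV2_raiseAt _ (by omega : M - k ≤ M), typeV_raiseAt _ (by omega : M - k ≤ M), typeTauV, hML]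
      push_cast [Nat.cast_sub hk]
      ring
  · -- `y` realises `1 :: T`, the conjugate realises `T ++ [1]`
    have e1 : ∀ j ≤ M, f j = consOne (tList T) j := fun j hj => hfk j (by omega)
    have e2 : ∀ j ≤ M, f (M - j) = snocOne (tList T) (tTop T) j := by
      intro j hj
      show netExp b (y + (M - j) * p) = _
      rw [hfk (M - j) (by omega), consOne, snocOne]
      by_cases hj0 : j = tTop T + 1
      · rw [if_pos (by omega), if_pos hj0]
      · rw [if_neg (by omega), if_neg hj0, ← hpalT j (by omega)]
        congr 1; omega
    have hcorr2 : typeCorr2 (tTop T) (tList T) = 0 := by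
      rw [hML] at hL hL'
      exact typeCorr2_eq_zero_of_consClass b hy hL hL' (tList T) (fun i hi => by rw [← hfk i hi]) hc0 hneg
    refine ⟨((tTop T : ℕ) : ℤ) + 2, ?_, ?_⟩
    · rw [typeW2_congr e1, typeW2_congr e2, typeW_congr e2, hML, typeW2_consOne, typeW2_snocOne, typeW_snocOne, typeTauW]
      push_cast
      ring
    · rw [typeV2_congr e1, typeV2_congr e2, typeV_congr e2, hML, typeV2_consOne, typeV2_snocOne, typeV_snocOne, typeTauV,
        hcorr2]
      push_cast
      ring
  · -- `y` realises `T ++ [1]`, the conjugate realises `1 :: T`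
    have e1 : ∀ j ≤ M, f j = snocOne (tList T) (tTop T) j := fun j hj => hfk j (by omega)
    have e2 : ∀ j ≤ M, f (M - j) = consOne (tList T) j := by
      intro j hj
      show netExp b (y + (M - j) * p) = _
      rw [hfk (M - j) (by omega), consOne, snocOne]
      by_cases hj0 : j = 0
      · rw [if_pos (by omega), if_pos hj0]
      · rw [if_neg (by omega), if_neg hj0, ← hpalT (j - 1) (by omega)]
        congr 1; omega
    have hfc' : ∀ i ≤ tTop T + 1, netExp b (conjClass b p y + i * p) = consOne (tList T) i := by
      intro i hi; rw [hfc i (by omega)]; exact e2 i (by omega)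
    have hcorr : typeCorr (tTop T) (tList T) = 0 := by
      rw [hML] at hM2 hM2'
      exact typeCorr_eq_zero_of_consClass b hy' hM2 hM2' (tList T) hfc' hc0' (by omega)
    have hcorr2 : typeCorr2 (tTop T) (tList T) = 0 := by
      rw [hML] at hM2 hM2'
      exact typeCorr2_eq_zero_of_consClass b hy' hM2 hM2' (tList T) hfc' hc0' hnegc
    refine ⟨-1, ?_, ?_⟩
    · rw [typeW2_congr e1, typeW2_congr e2, typeW_congr e2, hML, typeW2_consOne, typeW2_snocOne, typeW_consOne, typeTauW]
      push_cast
      ring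
    · rw [typeV2_congr e1, typeV2_congr e2, typeV_congr e2, hML, typeV2_consOne, typeV2_snocOne, typeV_consOne, typeTauV,
        hcorr, hcorr2]
      push_cast
      ring

end Live

end Summit.KontsevichZagierPeriods.Zeta5Search.SecondOrder

end
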